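import Literature.NumberTheory.Sieve.MontgomeryVaughan1975MajorArcs
import Literature.NumberTheory.Sieve.BombieriVinogradovFacts
import Mathlib.NumberTheory.Chebyshev
import Mathlib.Analysis.SumIntegralComparisons
import Mathlib.Analysis.SpecialFunctions.Integrals.Basic
import HarnessLib

/-!
# Montgomery–Vaughan (1975), Lemma 4.3: the prime sums `∑#_{x−h<p≤x} χ(p) log p` versus
`ψ(x, χ)` — PROVED bookkeeping

H. L. Montgomery, R. C. Vaughan, *The exceptional set in Goldbach's problem*, Acta Arith. 27
(1975) 353–370 [MontgomeryVaughanActa1975], §4, Lemma 4.3 (4.2) (= Gallagher, Invent. Math. 11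
(1970), Theorem 7, modified). The named fact `lemma43_gallagher` of the tree is stated for the
prime sums `charPrimeSum χ x h = ∑_{x−h<p≤x} χ(p) log p` and their corrected forms `gallagherTerm`
(`−∑_{x−h<n≤x} 1` when `q = 1`) and `gallagherTermExc` (`+∑_{x−h<n≤x} n^{β̃−1}` for `χ = χ̃`)
(`MontgomeryVaughan1975MajorArcs.lean`), whereas explicit formulae speak about
`ψ(x, χ) = ∑_{n≤x} χ(n)Λ(n)` (`Literature.NumberTheory.Sieve.chebyshevPsiChar`). This file is the
dictionary (all `x, y, h` natural numbers, as in (4.2)):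

* `chebyshevPsiChar_natCast_sub` — `ψ(x, χ) − ψ(y, χ) = ∑_{y<n≤x} χ(n)Λ(n)`;
* `sum_Ioc_mul_vonMangoldt_eq` — `∑_{x−h<n≤x} χ(n)Λ(n) = charPrimeSum χ x h + (prime powers)`,
  `norm_sum_nonprime_le` — the prime powers `p^k`, `k ≥ 2`, contribute at most
  `ψ(x) − ϑ(x) ≤ 2√x log x` (Mathlib's `Chebyshev.psi_sub_theta_le`);
* trivial bounds: `norm_charPrimeSum_le_theta` (`≤ ϑ(x) ≤ x log 4`), `norm_gallagherTerm_le`,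
  `norm_gallagherTermExc_le` (`≤ (log 4 + 2) x` for `β ≤ 1`), and monotonicity in `h` beyond `x`
  (`charPrimeSum_of_le`, …: for `h ≥ x` the sums do not depend on `h`);
* modulus `1`: `charPrimeSum_modOne` (`= ϑ(x) − ϑ(x − h)`), `sum_Ioc_mul_vonMangoldt_modOne`
  (`= ψ(x) − ψ(x − h)`);
* the exceptional correction versus the removed zero term: `abs_sum_rpow_sub_integral_le` —
  `|∑_{y<n≤x} n^{β−1} − (x^β − y^β)/β| ≤ y^{β−1} ≤ 1` for `1 ≤ y ≤ x`, `0 < β ≤ 1` (sum–integral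
  comparison for the decreasing `t ↦ t^{β−1}`), and its complex form `norm_sum_rpow_sub_cpow_div_le`.

No named facts.
-/

noncomputable section

open Finset Real
open scoped ArithmeticFunction.vonMangoldt Chebyshev

namespace Literature.NumberTheory.Sieve.MontgomeryVaughan1975

open Literature.NumberTheory.Sieve (chebyshevPsiChar)

/-! ### `ψ(x, χ)` over an interval of integers -/

/-- `ψ(x, χ) − ψ(y, χ) = ∑_{y<n≤x} χ(n)Λ(n)` for naturals `y ≤ x`. [folklore] -/
theorem chebyshevPsiChar_natCast_sub {q : ℕ} (χ : DirichletCharacter ℂ q) {y x : ℕ} (h : y ≤ x) :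
    chebyshevPsiChar χ x - chebyshevPsiChar χ y = ∑ n ∈ Ioc y x, χ n * Λ n := by
  rw [chebyshevPsiChar, chebyshevPsiChar, Nat.floor_natCast, Nat.floor_natCast,
    Finset.range_eq_Ico, Finset.range_eq_Ico,
    ← Finset.sum_Ico_consecutive _ (Nat.zero_le (y + 1)) (by omega : y + 1 ≤ x + 1),
    add_sub_cancel_left, Finset.Ico_add_one_add_one_eq_Ioc]

/-- `∑_{x−h<n≤x} χ(n)Λ(n) = ∑_{x−h<p≤x} χ(p) log p + ∑_{x−h<n≤x, n not prime} χ(n)Λ(n)`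
(`Λ(p) = log p`). [folklore] -/
theorem sum_Ioc_mul_vonMangoldt_eq {q : ℕ} (χ : DirichletCharacter ℂ q) (x h : ℕ) :
    ∑ n ∈ Ioc (x - h) x, χ n * Λ n =
      charPrimeSum χ x h + ∑ n ∈ (Ioc (x - h) x).filter (fun n => ¬ n.Prime), χ n * Λ n := by
  rw [charPrimeSum, ← Finset.sum_filter_add_sum_filter_not (Ioc (x - h) x) Nat.Prime]
  congr 1
  refine Finset.sum_congr rfl fun p hp => ?_
  rw [Finset.mem_filter] at hp
  rw [ArithmeticFunction.vonMangoldt_apply_prime hp.2]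

/-- The prime powers `p^k`, `k ≥ 2`: `‖∑_{x−h<n≤x, n not prime} χ(n)Λ(n)‖ ≤ ψ(x) − ϑ(x)`.
[folklore] -/
theorem norm_sum_nonprime_le_psi_sub_theta {q : ℕ} (χ : DirichletCharacter ℂ q) (x h : ℕ) :
    ‖∑ n ∈ (Ioc (x - h) x).filter (fun n => ¬ n.Prime), χ n * Λ n‖ ≤ ψ x - θ x := by
  rw [Chebyshev.psi_sub_theta_eq_sum_not_prime, Nat.floor_natCast]
  refine (norm_sum_le _ _).trans ?_
  have hterm : ∀ n : ℕ, ‖χ (n : ZMod q) * ((Λ n : ℝ) : ℂ)‖ ≤ Λ n := by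
    intro n
    rw [norm_mul, Complex.norm_real, Real.norm_of_nonneg ArithmeticFunction.vonMangoldt_nonneg]
    exact mul_le_of_le_one_left ArithmeticFunction.vonMangoldt_nonneg (χ.norm_le_one _)
  calc ∑ n ∈ (Ioc (x - h) x).filter (fun n => ¬ n.Prime), ‖χ (n : ZMod q) * (Λ n : ℂ)‖
      ≤ ∑ n ∈ (Ioc (x - h) x).filter (fun n => ¬ n.Prime), (Λ n : ℝ) :=
        Finset.sum_le_sum fun n _ => hterm n
    _ ≤ ∑ n ∈ (Ioc 0 x).filter (fun n => ¬ n.Prime), (Λ n : ℝ) := by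
        apply Finset.sum_le_sum_of_subset_of_nonneg
        · intro n hn
          rw [Finset.mem_filter, Finset.mem_Ioc] at hn ⊢
          exact ⟨⟨by omega, hn.1.2⟩, hn.2⟩
        · intro n _ _
          exact ArithmeticFunction.vonMangoldt_nonneg

/-- The prime powers contribute at most `2√x log x`. [folklore] -/
theorem norm_sum_nonprime_le {q : ℕ} (χ : DirichletCharacter ℂ q) (x h : ℕ) :
    ‖∑ n ∈ (Ioc (x - h) x).filter (fun n => ¬ n.Prime), χ n * Λ n‖ ≤
      2 * Real.sqrt x * Real.log x := by
  rcases Nat.eq_zero_or_pos x with hx | hx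
  · subst hx
    simp
  · exact (norm_sum_nonprime_le_psi_sub_theta χ x h).trans
      (Chebyshev.psi_sub_theta_le (by exact_mod_cast hx))

/-! ### Trivial bounds -/

/-- `‖∑_{x−h<p≤x} χ(p) log p‖ ≤ ϑ(x)`. [folklore] -/
theorem norm_charPrimeSum_le_theta {q : ℕ} (χ : DirichletCharacter ℂ q) (x h : ℕ) :
    ‖charPrimeSum χ x h‖ ≤ θ x := by
  rw [charPrimeSum, Chebyshev.theta, Nat.floor_natCast]
  refine (norm_sum_le _ _).trans ?_
  have hterm : ∀ p ∈ (Ioc (x - h) x).filter Nat.Prime,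
      ‖χ (p : ZMod q) * (Real.log p : ℂ)‖ ≤ Real.log p := by
    intro p hp
    rw [Finset.mem_filter] at hp
    have hlog : 0 ≤ Real.log p := Real.log_natCast_nonneg p
    rw [norm_mul, Complex.norm_real, Real.norm_of_nonneg hlog]
    exact mul_le_of_le_one_left hlog (χ.norm_le_one _)
  calc ∑ p ∈ (Ioc (x - h) x).filter Nat.Prime, ‖χ (p : ZMod q) * (Real.log p : ℂ)‖
      ≤ ∑ p ∈ (Ioc (x - h) x).filter Nat.Prime, Real.log p := Finset.sum_le_sum hterm
    _ ≤ ∑ p ∈ (Ioc 0 x).filter Nat.Prime, Real.log p := by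
        apply Finset.sum_le_sum_of_subset_of_nonneg
        · intro p hp
          rw [Finset.mem_filter, Finset.mem_Ioc] at hp ⊢
          exact ⟨⟨by omega, hp.1.2⟩, hp.2⟩
        · intro p _ _
          exact Real.log_natCast_nonneg p

/-- `‖∑_{x−h<p≤x} χ(p) log p‖ ≤ x log 4` (Chebyshev). [folklore] -/
theorem norm_charPrimeSum_le {q : ℕ} (χ : DirichletCharacter ℂ q) (x h : ℕ) :
    ‖charPrimeSum χ x h‖ ≤ Real.log 4 * x :=
  (norm_charPrimeSum_le_theta χ x h).trans (Chebyshev.theta_le_log4_mul_x (Nat.cast_nonneg x))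

/-- The integer count: `#(x−h, x] ≤ x`. [folklore] -/
theorem card_Ioc_sub_le (x h : ℕ) : (Ioc (x - h) x).card ≤ x := by
  rw [Nat.card_Ioc]; omega

/-- The integer count: `#(x−h, x] ≤ h`. [folklore] -/
theorem card_Ioc_sub_le' (x h : ℕ) : (Ioc (x - h) x).card ≤ h := by
  rw [Nat.card_Ioc]; omega

/-- `∑_{x−h<n≤x} n^{β−1} ≤ #(x−h, x]` for `β ≤ 1` (each term is `≤ 1` as `n ≥ 1`). [folklore] -/
theorem sum_Ioc_rpow_le_card (x h : ℕ) {β : ℝ} (hβ : β ≤ 1) :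
    ∑ n ∈ Ioc (x - h) x, (n : ℝ) ^ (β - 1) ≤ (Ioc (x - h) x).card := by
  have hterm : ∀ n ∈ Ioc (x - h) x, (n : ℝ) ^ (β - 1) ≤ 1 := by
    intro n hn
    rw [Finset.mem_Ioc] at hn
    exact Real.rpow_le_one_of_one_le_of_nonpos (by exact_mod_cast (show 1 ≤ n by omega))
      (by linarith)
  calc ∑ n ∈ Ioc (x - h) x, (n : ℝ) ^ (β - 1) ≤ ∑ n ∈ Ioc (x - h) x, (1 : ℝ) :=
        Finset.sum_le_sum hterm
    _ = (Ioc (x - h) x).card := by rw [Finset.sum_const, nsmul_eq_mul, mul_one]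

/-- `∑_{x−h<n≤x} n^{β−1} ≥ 0`. [folklore] -/
theorem sum_Ioc_rpow_nonneg (x h : ℕ) (β : ℝ) : 0 ≤ ∑ n ∈ Ioc (x - h) x, (n : ℝ) ^ (β - 1) :=
  Finset.sum_nonneg fun n _ => Real.rpow_nonneg (Nat.cast_nonneg n) _

/-- Trivial bound for `∑#` without exceptional correction: `‖gallagherTerm χ x h‖ ≤ (log 4 + 1) x`.
[folklore] -/
theorem norm_gallagherTerm_le {q : ℕ} (χ : DirichletCharacter ℂ q) (x h : ℕ) :
    ‖gallagherTerm χ x h‖ ≤ (Real.log 4 + 1) * x := by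
  rw [gallagherTerm]
  refine (norm_sub_le _ _).trans ?_
  have h1 := norm_charPrimeSum_le χ x h
  have h2 : ‖(if q = 1 then (((Ioc (x - h) x).card : ℕ) : ℂ) else 0)‖ ≤ x := by
    split_ifs
    · rw [Complex.norm_natCast]; exact_mod_cast card_Ioc_sub_le x h
    · rw [norm_zero]; exact Nat.cast_nonneg x
  linarith

open scoped Classical in
/-- Trivial bound for `∑#` with exceptional correction (`β ≤ 1`):
`‖gallagherTermExc χ̃ β χ x h‖ ≤ (log 4 + 2) x`. [folklore] -/
theorem norm_gallagherTermExc_le {r : ℕ} (χe : DirichletCharacter ℂ r) {β : ℝ} (hβ : β ≤ 1)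
    {q : ℕ} (χ : DirichletCharacter ℂ q) (x h : ℕ) :
    ‖gallagherTermExc χe β χ x h‖ ≤ (Real.log 4 + 2) * x := by
  rw [gallagherTermExc]
  refine (norm_add_le _ _).trans ?_
  have h1 := norm_gallagherTerm_le χ x h
  have h2 : ‖(if q = r ∧ ∀ n : ℕ, χ (n : ZMod q) = χe (n : ZMod r) then
      ((∑ n ∈ Ioc (x - h) x, (n : ℝ) ^ (β - 1) : ℝ) : ℂ) else 0)‖ ≤ x := by
    split_ifs
    · rw [Complex.norm_real, Real.norm_of_nonneg (sum_Ioc_rpow_nonneg x h β)]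
      exact (sum_Ioc_rpow_le_card x h hβ).trans (by exact_mod_cast card_Ioc_sub_le x h)
    · rw [norm_zero]; exact Nat.cast_nonneg x
  linarith

/-! ### Intervals longer than `x`: the sums only depend on `min(h, x)` -/

/-- For `h ≥ x` the interval `(x − h, x]` of naturals is `(0, x]`. [folklore] -/
theorem Ioc_sub_of_le {x h : ℕ} (hx : x ≤ h) : Ioc (x - h) x = Ioc 0 x := by
  rw [Nat.sub_eq_zero_of_le hx]

/-- `charPrimeSum χ x h = charPrimeSum χ x x` for `h ≥ x`. [folklore] -/
theorem charPrimeSum_of_le {q : ℕ} (χ : DirichletCharacter ℂ q) {x h : ℕ} (hx : x ≤ h) :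
    charPrimeSum χ x h = charPrimeSum χ x x := by
  rw [charPrimeSum, charPrimeSum, Ioc_sub_of_le hx, Nat.sub_self]

/-- `gallagherTerm χ x h = gallagherTerm χ x x` for `h ≥ x`. [folklore] -/
theorem gallagherTerm_of_le {q : ℕ} (χ : DirichletCharacter ℂ q) {x h : ℕ} (hx : x ≤ h) :
    gallagherTerm χ x h = gallagherTerm χ x x := by
  rw [gallagherTerm, gallagherTerm, charPrimeSum_of_le χ hx, Ioc_sub_of_le hx, Nat.sub_self]

open scoped Classical in
/-- `gallagherTermExc χ̃ β χ x h = gallagherTermExc χ̃ β χ x x` for `h ≥ x`. [folklore] -/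
theorem gallagherTermExc_of_le {r : ℕ} (χe : DirichletCharacter ℂ r) (β : ℝ) {q : ℕ}
    (χ : DirichletCharacter ℂ q) {x h : ℕ} (hx : x ≤ h) :
    gallagherTermExc χe β χ x h = gallagherTermExc χe β χ x x := by
  rw [gallagherTermExc, gallagherTermExc, gallagherTerm_of_le χ hx, Ioc_sub_of_le hx, Nat.sub_self]

/-- The weight is monotone: `(h + N/P)⁻¹ ≤ (x + N/P)⁻¹` for `x ≤ h` (`N/P > 0`). [folklore] -/
theorem inv_add_le_inv_add {x h : ℕ} (hx : x ≤ h) {D : ℝ} (hD : 0 < D) :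
    ((h : ℝ) + D)⁻¹ ≤ ((x : ℝ) + D)⁻¹ := by
  apply inv_anti₀ (by positivity)
  have : (x : ℝ) ≤ h := by exact_mod_cast hx
  linarith

/-! ### Modulus `1`: the sums are `ϑ` and `ψ` -/

/-- A character modulo `1` is identically `1` on `ℕ`. [folklore] -/
theorem modOne_apply_natCast (χ : DirichletCharacter ℂ 1) (n : ℕ) : χ (n : ZMod 1) = 1 := by
  rw [DirichletCharacter.level_one χ]
  exact MulChar.one_apply (isUnit_of_subsingleton _)

/-- Modulo `1`: `∑_{x−h<p≤x} χ(p) log p = ϑ(x) − ϑ(x − h)`. [folklore] -/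
theorem charPrimeSum_modOne (χ : DirichletCharacter ℂ 1) (x h : ℕ) :
    charPrimeSum χ x h = ((θ x - θ ((x - h : ℕ) : ℝ) : ℝ) : ℂ) := by
  rw [charPrimeSum, Chebyshev.theta, Chebyshev.theta, Nat.floor_natCast, Nat.floor_natCast]
  have hsplit : (Ioc 0 x).filter Nat.Prime =
      (Ioc 0 (x - h)).filter Nat.Prime ∪ (Ioc (x - h) x).filter Nat.Prime := by
    rw [← Finset.filter_union, Finset.Ioc_union_Ioc_eq_Ioc (Nat.zero_le _) (Nat.sub_le x h)]
  have hdisj : Disjoint ((Ioc 0 (x - h)).filter Nat.Prime) ((Ioc (x - h) x).filter Nat.Prime) :=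
    Finset.disjoint_filter_filter (Finset.Ioc_disjoint_Ioc_of_le le_rfl)
  rw [hsplit, Finset.sum_union hdisj, add_sub_cancel_left]
  push_cast
  refine Finset.sum_congr rfl fun p _ => ?_
  rw [modOne_apply_natCast, one_mul]

/-- Modulo `1`: `∑_{x−h<n≤x} χ(n)Λ(n) = ψ(x) − ψ(x − h)`. [folklore] -/
theorem sum_Ioc_mul_vonMangoldt_modOne (χ : DirichletCharacter ℂ 1) (x h : ℕ) :
    ∑ n ∈ Ioc (x - h) x, χ n * (Λ n : ℂ) = ((ψ x - ψ ((x - h : ℕ) : ℝ) : ℝ) : ℂ) := by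
  rw [Chebyshev.psi, Chebyshev.psi, Nat.floor_natCast, Nat.floor_natCast,
    ← Finset.sum_Ioc_consecutive _ (Nat.zero_le (x - h)) (Nat.sub_le x h), add_sub_cancel_left]
  push_cast
  refine Finset.sum_congr rfl fun n _ => ?_
  rw [modOne_apply_natCast, one_mul]

/-! ### The exceptional correction versus the removed zero term -/

/-- `t ↦ t^{β−1}` is antitone on `[y, ∞)` for `y > 0`, `β ≤ 1`. [folklore] -/
theorem antitoneOn_rpow_sub_one {β : ℝ} (hβ : β ≤ 1) {y : ℝ} (hy : 0 < y) (s : Set ℝ)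
    (hs : s ⊆ Set.Ici y) : AntitoneOn (fun t : ℝ => t ^ (β - 1)) s := by
  intro a ha b hb hab
  have ha0 : 0 < a := lt_of_lt_of_le hy (hs ha)
  exact Real.rpow_le_rpow_of_nonpos ha0 hab (by linarith)

/-- **Sum versus integral for the exceptional correction**: for naturals `1 ≤ y ≤ x` and
`0 < β ≤ 1`, `|∑_{y<n≤x} n^{β−1} − (x^β − y^β)/β| ≤ y^{β−1}` (the function `t ↦ t^{β−1}` decreases,
and `∫_y^x t^{β−1} dt = (x^β − y^β)/β`). This compares the correction `+∑ n^{β̃−1}` of Lemma 4.3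
with the term `(x^{β̃} − y^{β̃})/β̃` of the exceptional zero in the explicit formula.
[cite: MontgomeryVaughanActa1975, §4 Lemma 4.3 (4.2)] -/
theorem abs_sum_rpow_sub_integral_le {y x : ℕ} (hy : 1 ≤ y) (hyx : y ≤ x) {β : ℝ} (hβ0 : 0 < β)
    (hβ : β ≤ 1) :
    |∑ n ∈ Ioc y x, (n : ℝ) ^ (β - 1) - ((x : ℝ) ^ β - (y : ℝ) ^ β) / β| ≤ (y : ℝ) ^ (β - 1) := by
  have hy0 : (0 : ℝ) < y := by exact_mod_cast hy
  -- the integral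
  have hint : ∫ t in (y : ℝ)..(x : ℝ), t ^ (β - 1) = ((x : ℝ) ^ β - (y : ℝ) ^ β) / β := by
    rw [integral_rpow (Or.inl (by linarith)), sub_add_cancel]
  -- antitone on `[y, x]`
  have hanti : AntitoneOn (fun t : ℝ => t ^ (β - 1)) (Set.Icc (y : ℝ) (x : ℝ)) :=
    antitoneOn_rpow_sub_one hβ hy0 _ fun t ht => ht.1
  have hup : ∑ i ∈ Finset.Ico y x, (((i + 1 : ℕ) : ℝ)) ^ (β - 1) ≤
      ∫ t in (y : ℝ)..(x : ℝ), t ^ (β - 1) := hanti.sum_le_integral_Ico hyx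
  have hlow : ∫ t in (y : ℝ)..(x : ℝ), t ^ (β - 1) ≤
      ∑ i ∈ Finset.Ico y x, ((i : ℕ) : ℝ) ^ (β - 1) := hanti.integral_le_sum_Ico hyx
  -- reindex the sums
  have h1 : ∑ i ∈ Finset.Ico y x, (((i + 1 : ℕ) : ℝ)) ^ (β - 1) =
      ∑ n ∈ Ioc y x, (n : ℝ) ^ (β - 1) := by
    rw [Finset.sum_Ico_add' (fun n : ℕ => (n : ℝ) ^ (β - 1)) y x 1,
      Finset.Ico_add_one_add_one_eq_Ioc]
  have h2 : ∑ i ∈ Finset.Ico y x, ((i : ℕ) : ℝ) ^ (β - 1) ≤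
      (y : ℝ) ^ (β - 1) + ∑ n ∈ Ioc y x, (n : ℝ) ^ (β - 1) := by
    rcases eq_or_lt_of_le hyx with heq | hlt
    · subst heq
      simp only [Finset.Ico_self, Finset.Ioc_self, Finset.sum_empty, add_zero]
      exact Real.rpow_nonneg hy0.le _
    · rw [Finset.sum_eq_sum_Ico_succ_bot hlt]
      refine add_le_add le_rfl ?_
      apply Finset.sum_le_sum_of_subset_of_nonneg
      · intro n hn
        rw [Finset.mem_Ico] at hn
        rw [Finset.mem_Ioc]
        omega
      · intro n _ _
        exact Real.rpow_nonneg (Nat.cast_nonneg n) _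
  rw [h1] at hup
  rw [abs_le]
  constructor
  · linarith
  · linarith [Real.rpow_nonneg hy0.le (β - 1)]

/-- The same, bounded by `1` (`y^{β−1} ≤ 1`). [cite: MontgomeryVaughanActa1975, §4 Lemma 4.3 (4.2)] -/
theorem abs_sum_rpow_sub_integral_le_one {y x : ℕ} (hy : 1 ≤ y) (hyx : y ≤ x) {β : ℝ}
    (hβ0 : 0 < β) (hβ : β ≤ 1) :
    |∑ n ∈ Ioc y x, (n : ℝ) ^ (β - 1) - ((x : ℝ) ^ β - (y : ℝ) ^ β) / β| ≤ 1 :=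
  (abs_sum_rpow_sub_integral_le hy hyx hβ0 hβ).trans
    (Real.rpow_le_one_of_one_le_of_nonpos (by exact_mod_cast hy) (by linarith))

/-- **Complex form**: with `ρ = β` real, the zero term `(x^ρ − y^ρ)/ρ` of the explicit formula
is within `1` of the correction: `‖∑_{y<n≤x} n^{β−1} − (x^β − y^β)/β‖ ≤ 1` in `ℂ`, for naturals
`1 ≤ y ≤ x`, `0 < β ≤ 1`. [cite: MontgomeryVaughanActa1975, §4 Lemma 4.3 (4.2)] -/
theorem norm_sum_rpow_sub_cpow_div_le {y x : ℕ} (hy : 1 ≤ y) (hyx : y ≤ x) {β : ℝ}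
    (hβ0 : 0 < β) (hβ : β ≤ 1) :
    ‖((∑ n ∈ Ioc y x, (n : ℝ) ^ (β - 1) : ℝ) : ℂ) -
        (((x : ℝ) : ℂ) ^ ((β : ℝ) : ℂ) - ((y : ℝ) : ℂ) ^ ((β : ℝ) : ℂ)) / ((β : ℝ) : ℂ)‖ ≤ 1 := by
  have hx0 : (0 : ℝ) ≤ x := Nat.cast_nonneg x
  have hy0 : (0 : ℝ) ≤ y := Nat.cast_nonneg y
  rw [← Complex.ofReal_cpow hx0, ← Complex.ofReal_cpow hy0, ← Complex.ofReal_sub,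
    ← Complex.ofReal_div, ← Complex.ofReal_sub, Complex.norm_real, Real.norm_eq_abs]
  exact abs_sum_rpow_sub_integral_le_one hy hyx hβ0 hβ

end Literature.NumberTheory.Sieve.MontgomeryVaughan1975
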